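import Summits.QuantumAdvantage.QuantumAdvantage.Theorems.SosSandwichPseudoBoundedAACompletelyBoundedWitness
import Summits.QuantumAdvantage.QuantumAdvantage.Theorems.SosSandwichPseudoBoundedAASpectralCorner
import Summits.QuantumAdvantage.QuantumAdvantage.Theorems.SosSandwichPseudoBoundedAAFixedOrder
import HarnessLib

/-!
# Crux `PseudoBoundedAA` (stmt-QuantumAdvantage-15237) — the COMPLETELY-BOUNDED CORNER, part 2:
# `maxᵢ Infᵢ[p] ≥ 4·Var[p]²/(deg² · ‖p‖²_cb,ord)`, so PB-AA holds on the corner with the SHARP exponents `(2, 2)`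

Part 1 (`…CompletelyBoundedWitness`) built, for any Walsh coefficients `c`, any level `D ≥ 1` and any `M > 0`
dominating the level-`D` influences, explicit contractions `A_j` and unit vectors with
`⟨f, (Σ_S c_S A_{s₁}⋯A_{s_k}) v⟩ = W_D/√M` (`W_D = Σ_{|S|=D} c_S²`).  Here:

* `exists_witness` — the same witness on `Fin m` (reindexing along `Fintype.equivFin`);
* `levelWeight_le` — the ROOT-INFLUENCE INEQUALITY in kernel form: if the ORDERED COMPLETELY BOUNDED NORM of `p` is
  at most `K`, i.e. `⟨f, p(A) v⟩ ≤ K` for every `m`, all contractions `A_j ∈ M_m(ℝ)` and unit `v, f ∈ ℝ^m`, where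
  `p(A) := Σ_S p̂(S) A_{s₁} A_{s₂} ⋯ A_{s_k}` (product over the elements of `S` in increasing order — for a
  block-multilinear form with increasing blocks this is `‖p‖_cb ≤ K` verbatim, Escudero Gutiérrez Eq. (19) /
  Bansal–Sinha–de Wolf §1.1; for a general `p` it is the cb-norm of `p` read as a block-multilinear form with
  singleton blocks), then `W_D[p] ≤ K·√M` whenever `M > 0` bounds every `Inf_j^{=D}[p] = Σ_{|S|=D, S∋j} p̂(S)²`;
* `exists_influence_ge_of_cb` — hence (`M = max_j Inf_j^{=D}`, `D` a level carrying `≥ Var/deg` of the variance,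
  `Inf_j = 4 Σ_{S∋j} p̂(S)² ≥ 4 Inf_j^{=D}`): **`∃ i, 4·(ε/(d·K))² ≤ Infᵢ[p]`** for every `p` of total degree `≤ d`
  with `Var[p] ≥ ε > 0` — the Aaronson–Ambainis conclusion with exponent `2` and NO boundedness hypothesis other than
  the cb-norm (Escudero Gutiérrez Thm. 1.8 = Bansal–Sinha–de Wolf Thm. 1.3 with the number of blocks replaced by the
  degree and the constant `e(d+1)⁴` replaced by `d²/4`);
* `pseudoBoundedAA_cbCorner`, `pseudoBoundedAA_cbCorner_literal` — for `p ∈ K_T` (pseudo-bounded of order `T`, so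
  Walsh degree `≤ 2T`) with ordered cb-norm `≤ K`: **`∃ i, (ε/(T·K))² ≤ Infᵢ[p]`**; at `K = 1` this is the body of
  the route decl `PseudoBoundedAA` with `(c, C) = (2, 1)` — the card's SHARP exponent pair `(2, 2)` — on the corner,
  the second theorem in the item's literal inline vocabulary.

Honest label (so that nobody is misled): a published special case in kernel form, `--supports` the open crux.  The
corner is NOT KNOWN to contain `Q_T`: the acceptance probability of a `T`-query algorithm is characterised by the
SYMMETRISED Fourier cb-norm `‖p‖_{fcb,2T} ≤ 1` with Boolean behaviour (Escudero Gutiérrez Thm. 1.4), a different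
functional from the ordered evaluation used here (AA on `{‖p‖_{fcb,d} ≤ 1}` is his Conjecture 1.5, open; Thm. 1.6
is its homogeneous case); whether the ordered cb-norm is `≤ poly(T)` on `Q_T` or on `K_T` — which by
`pseudoBoundedAA_cbCorner` would give PB-AA there with `c = 2 + 2κ` — is not decided in the tree (the address family
of `not_HomogeneousPBAA` forces at least `√T/2`, part 3).  No stub, crux or summit is closed.
Sources: EscuderoGutierrez2023 (arXiv:2304.06713) Thm. 1.8, Eq. (19), (22)–(23), Remark 4.1; BansalSinhaDeWolf2022
(arXiv:2203.00212) Thm. 1.3–1.4, Cor. 1.5; ODonnell2014 §1.4, §2.2; KaniewskiLeeDewolf2015 Def. 7 (`K_T`).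
-/

-- D-0017: single-conjunct summit ⇒ the duplicate `QuantumAdvantage.QuantumAdvantage` is mandated.
set_option linter.dupNamespace false

noncomputable section

open Finset Matrix
open Literature.Computability.QuantumComplexity
open Literature.Computability.Complexity.LowDegree (cubeFourierCoeff)

namespace Summit.QuantumAdvantage.QuantumAdvantage.Theorems.SosSandwich.CompletelyBoundedCorner

variable {N : ℕ}

/-- **Transport of a matrix witness along a bijection of index sets** (bookkeeping): reindexing the matrices and
vectors along `e : ι ≃ κ` preserves the contraction property, the norms, and the pairing `⟨f, (Σ_S c_S A_S) v⟩`.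
[folklore] -/
theorem transport_witness {ι κ : Type} [Fintype ι] [DecidableEq ι] [Fintype κ] [DecidableEq κ] (e : ι ≃ κ)
    (A : Fin N → Matrix ι ι ℝ) (v f : ι → ℝ) (c : Finset (Fin N) → ℝ)
    (hA : ∀ j w, ∑ a, (A j *ᵥ w) a ^ 2 ≤ ∑ a, w a ^ 2) :
    (∀ j w, ∑ a, (Matrix.reindex e e (A j) *ᵥ w) a ^ 2 ≤ ∑ a, w a ^ 2) ∧
      ∑ a, (v ∘ e.symm) a ^ 2 = ∑ a, v a ^ 2 ∧ ∑ a, (f ∘ e.symm) a ^ 2 = ∑ a, f a ^ 2 ∧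
      (f ∘ e.symm) ⬝ᵥ ((∑ S : Finset (Fin N), c S • ((S.sort).map (fun j => Matrix.reindex e e (A j))).prod) *ᵥ
          (v ∘ e.symm)) =
        f ⬝ᵥ ((∑ S : Finset (Fin N), c S • ((S.sort).map A).prod) *ᵥ v) := by
  classical
  have hmv : ∀ (P : Matrix ι ι ℝ) (w : κ → ℝ), Matrix.reindex e e P *ᵥ w = (P *ᵥ (w ∘ e)) ∘ e.symm := by
    intro P w
    rw [Matrix.reindex_apply, Matrix.submatrix_mulVec_equiv, Equiv.symm_symm]
  refine ⟨?_, e.symm.sum_comp (fun i => v i ^ 2), e.symm.sum_comp (fun i => f i ^ 2), ?_⟩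
  · intro j w
    rw [hmv]
    calc ∑ a, ((A j *ᵥ (w ∘ e)) ∘ e.symm) a ^ 2 = ∑ i, (A j *ᵥ (w ∘ e)) i ^ 2 :=
          e.symm.sum_comp (fun i => (A j *ᵥ (w ∘ e)) i ^ 2)
      _ ≤ ∑ i, (w ∘ e) i ^ 2 := hA j (w ∘ e)
      _ = ∑ a, w a ^ 2 := e.sum_comp (fun a => w a ^ 2)
  · -- the reindexing is an algebra map, so it passes through the sum of ordered products
    have hP : Matrix.reindexAlgEquiv ℝ ℝ e (∑ S : Finset (Fin N), c S • ((S.sort).map A).prod) =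
        ∑ S : Finset (Fin N), c S • ((S.sort).map (fun j => Matrix.reindex e e (A j))).prod := by
      rw [map_sum]
      refine Finset.sum_congr rfl fun S _ => ?_
      rw [map_smul, map_list_prod, List.map_map, Matrix.coe_reindexAlgEquiv]
      rfl
    have hve : (v ∘ ⇑e.symm) ∘ ⇑e = v := by
      ext i; simp only [Function.comp_apply, Equiv.symm_apply_apply]
    -- for an ABSTRACT matrix `P` (keeps definitional unfolding away from the big sum)
    have key : ∀ P : Matrix ι ι ℝ,
        (f ∘ e.symm) ⬝ᵥ (Matrix.reindex e e P *ᵥ (v ∘ e.symm)) = f ⬝ᵥ (P *ᵥ v) := by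
      intro P
      rw [hmv, hve]
      unfold dotProduct
      exact e.symm.sum_comp (fun i => f i * (P *ᵥ v) i)
    rw [← hP, Matrix.coe_reindexAlgEquiv]
    exact key _

/-- **The creation/annihilation witness on `ℝ^m`** (Part 1 reindexed along `Fintype.equivFin`): for coefficients
`c`, a level `D ≥ 1` and `M > 0` with `Σ_{|S|=D, S∋j} c_S² ≤ M` for all `j`, there are `m`, contractions
`A_j ∈ M_m(ℝ)` and unit vectors `v, f ∈ ℝ^m` with `⟨f, (Σ_S c_S A_{s₁}⋯A_{s_k}) v⟩ = (Σ_{|S|=D} c_S²)/√M`.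
[cite: EscuderoGutierrez2023, Thm. 1.8 (proof, Eq. (23))] [cite: BansalSinhaDeWolf2022, Thm. 1.4] -/
theorem exists_witness (c : Finset (Fin N) → ℝ) {D : ℕ} (hD : 1 ≤ D) {M : ℝ} (hM : 0 < M)
    (hMb : ∀ j : Fin N, ∑ S with (S.card = D ∧ j ∈ S), c S ^ 2 ≤ M) :
    ∃ (m : ℕ) (A : Fin N → Matrix (Fin m) (Fin m) ℝ) (v f : Fin m → ℝ),
      (∀ j w, ∑ a, (A j *ᵥ w) a ^ 2 ≤ ∑ a, w a ^ 2) ∧ ∑ a, v a ^ 2 = 1 ∧ ∑ a, f a ^ 2 = 1 ∧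
      f ⬝ᵥ ((∑ S : Finset (Fin N), c S • ((S.sort).map A).prod) *ᵥ v) =
        (∑ S with S.card = D, c S ^ 2) / √M := by
  classical
  obtain ⟨A, v, f, hA, hv, hf, hpair⟩ := exists_witness_option c hD hM hMb
  obtain ⟨h1, h2, h3, h4⟩ :=
    transport_witness (Fintype.equivFin (Option (Finset (Fin N)))) A v f c hA
  exact ⟨_, _, _, _, h1, h2.trans hv, h3.trans hf, h4.trans hpair⟩

/-- **The root-influence inequality, kernel form.**  If the ordered completely bounded norm of `p` is `≤ K`
(`⟨f, p(A) v⟩ ≤ K` for all contractions `A_j ∈ M_m(ℝ)` and unit `v, f`, `p(A) = Σ_S p̂(S) A_{s₁}⋯A_{s_k}` in increasing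
order of the variables of `S`), then for every level `D ≥ 1` and every `M > 0` bounding the level-`D` influences
`Σ_{|S|=D, S∋j} p̂(S)²`, the level weight satisfies `W_D[p] = Σ_{|S|=D} p̂(S)² ≤ K·√M`.
(With `M = maxⱼ Inf_j^{=D}` this is Escudero Gutiérrez's Eq. (23): `maxInf^{=D} ≥ (W_D/‖p‖_cb)²`.)
[cite: EscuderoGutierrez2023, Thm. 1.8 (Eq. (23)), Remark 4.1] [cite: BansalSinhaDeWolf2022, Thm. 1.4] -/
theorem levelWeight_le (p : MvPolynomial (Fin N) ℝ) {K : ℝ}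
    (hcb : ∀ (m : ℕ) (A : Fin N → Matrix (Fin m) (Fin m) ℝ) (v f : Fin m → ℝ),
      (∀ j w, ∑ a, (A j *ᵥ w) a ^ 2 ≤ ∑ a, w a ^ 2) → ∑ a, v a ^ 2 = 1 → ∑ a, f a ^ 2 = 1 →
      f ⬝ᵥ ((∑ S : Finset (Fin N), cubeFourierCoeff (evalBool p) S • ((S.sort).map A).prod) *ᵥ v) ≤ K)
    {D : ℕ} (hD : 1 ≤ D) {M : ℝ} (hM : 0 < M)
    (hMb : ∀ j : Fin N, ∑ S with (S.card = D ∧ j ∈ S), cubeFourierCoeff (evalBool p) S ^ 2 ≤ M) :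
    ∑ S with S.card = D, cubeFourierCoeff (evalBool p) S ^ 2 ≤ K * √M := by
  obtain ⟨m, A, v, f, hA, hv, hf, hpair⟩ := exists_witness (cubeFourierCoeff (evalBool p)) hD hM hMb
  have h := hcb m A v f hA hv hf
  rwa [hpair, div_le_iff₀ (Real.sqrt_pos.mpr hM)] at h

/-- **The Aaronson–Ambainis conclusion on the completely-bounded corner** (Bansal–Sinha–de Wolf / Escudero
Gutiérrez, with the number of blocks replaced by the degree): a real polynomial `p` of total degree `≤ d` (`d ≥ 1`)
whose ordered completely bounded norm is `≤ K` and whose cube variance is `≥ ε > 0` has a variable with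
`Infᵢ[p] ≥ 4 (ε/(d K))²`.  Proof: some level `1 ≤ D ≤ d` carries `W_D ≥ Var/d`; with `M = maxⱼ Inf_j^{=D}` the
root-influence inequality gives `W_D² ≤ K² M`, and `Inf_j = 4 Σ_{S∋j} p̂(S)² ≥ 4 Inf_j^{=D}`.
[cite: EscuderoGutierrez2023, Thm. 1.8] [cite: BansalSinhaDeWolf2022, Thm. 1.3] -/
theorem exists_influence_ge_of_cb {d : ℕ} (hd : 1 ≤ d) (p : MvPolynomial (Fin N) ℝ) (hp : p.totalDegree ≤ d)
    {K : ℝ} (hK : 0 < K)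
    (hcb : ∀ (m : ℕ) (A : Fin N → Matrix (Fin m) (Fin m) ℝ) (v f : Fin m → ℝ),
      (∀ j w, ∑ a, (A j *ᵥ w) a ^ 2 ≤ ∑ a, w a ^ 2) → ∑ a, v a ^ 2 = 1 → ∑ a, f a ^ 2 = 1 →
      f ⬝ᵥ ((∑ S : Finset (Fin N), cubeFourierCoeff (evalBool p) S • ((S.sort).map A).prod) *ᵥ v) ≤ K)
    {ε : ℝ} (hε : 0 < ε) (hvar : ε ≤ boolVariance p) :
    ∃ i : Fin N, 4 * (ε / (d * K)) ^ 2 ≤ influence i p := by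
  classical
  set g : Finset (Fin N) → ℝ := cubeFourierCoeff (evalBool p) with hg
  set W : ℕ → ℝ := fun D => ∑ S with S.card = D, g S ^ 2 with hW
  -- the Parseval sum split into levels `0, …, d` (no weight above the degree)
  have hlevel : ∀ S : Finset (Fin N),
      g S ^ 2 = ∑ D ∈ Finset.range (d + 1), if S.card = D then g S ^ 2 else 0 := by
    intro S
    by_cases hS : S.card ≤ d
    · rw [Finset.sum_ite_eq (Finset.range (d + 1)) S.card, if_pos (Finset.mem_range.mpr (by omega))]
    · have h0 : g S ^ 2 = 0 := by
        rw [hg, cubeFourierCoeff_evalBool_eq_zero hp (by omega)]; ring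
      rw [h0]
      exact (Finset.sum_eq_zero fun D hD => by
        rw [Finset.mem_range] at hD; rw [if_neg (by omega)]).symm
  have hsplit : ∑ S, g S ^ 2 = ∑ D ∈ Finset.range (d + 1), W D := by
    rw [Finset.sum_congr rfl fun S _ => hlevel S, Finset.sum_comm]
    refine Finset.sum_congr rfl fun D _ => ?_
    simp only [hW]
    rw [Finset.sum_filter]
  have hW0 : W 0 = g ∅ ^ 2 := by
    have h0 : (Finset.univ.filter fun S : Finset (Fin N) => S.card = 0) = {∅} := by
      ext S; simp [Finset.card_eq_zero]
    simp only [hW]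
    rw [h0, Finset.sum_singleton]
  have hvar_eq : boolVariance p = ∑ i ∈ Finset.range d, W (i + 1) := by
    rw [SpectralCorner.boolVariance_eq_sum_sq_sub_empty, ← hg, hsplit, Finset.sum_range_succ', hW0]
    ring
  -- a level `D = i + 1` carrying at least `Var/d`
  obtain ⟨i, hi, hWi⟩ : ∃ i ∈ Finset.range d, boolVariance p / d ≤ W (i + 1) := by
    refine Finset.exists_le_of_sum_le (Finset.nonempty_range_iff.mpr (by omega)) ?_
    rw [Finset.sum_const, Finset.card_range, nsmul_eq_mul, hvar_eq]
    have hd0 : (d : ℝ) ≠ 0 := by exact_mod_cast (show d ≠ 0 by omega)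
    rw [mul_div_cancel₀ _ hd0]
  set D := i + 1 with hD
  have hD1 : 1 ≤ D := by omega
  have hdpos : (0 : ℝ) < d := by exact_mod_cast (show 0 < d by omega)
  have hWD : ε / d ≤ W D := le_trans (div_le_div_of_nonneg_right hvar hdpos.le) hWi
  have hWpos : 0 < W D := lt_of_lt_of_le (div_pos hε hdpos) hWD
  -- a set of size `D` with nonzero coefficient, hence a variable
  obtain ⟨S₀, hS₀, hgS₀⟩ := Finset.exists_ne_zero_of_sum_ne_zero hWpos.ne'
  have hS₀D : S₀.card = D := (Finset.mem_filter.mp hS₀).2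
  obtain ⟨j₀, hj₀⟩ : S₀.Nonempty := Finset.card_pos.mp (by omega)
  -- the largest level-`D` influence
  set I : Fin N → ℝ := fun j => ∑ S with (S.card = D ∧ j ∈ S), g S ^ 2 with hI
  obtain ⟨jm, -, hjm⟩ := Finset.exists_max_image Finset.univ I ⟨j₀, Finset.mem_univ _⟩
  have hIj₀ : g S₀ ^ 2 ≤ I j₀ := by
    rw [hI]
    exact Finset.single_le_sum (f := fun S => g S ^ 2) (fun _ _ => sq_nonneg _)
      (Finset.mem_filter.mpr ⟨Finset.mem_univ _, hS₀D, hj₀⟩)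
  have hMpos : 0 < I jm := by
    have h1 : 0 < g S₀ ^ 2 := lt_of_le_of_ne (sq_nonneg _) (Ne.symm hgS₀)
    exact lt_of_lt_of_le (lt_of_lt_of_le h1 hIj₀) (hjm j₀ (Finset.mem_univ _))
  -- the root-influence inequality: `W_D ≤ K √M`
  have hroot : W D ≤ K * √(I jm) := levelWeight_le p hcb hD1 hMpos fun j => hjm j (Finset.mem_univ j)
  have hsq : W D ^ 2 ≤ K ^ 2 * I jm := by
    have h := mul_self_le_mul_self hWpos.le hroot
    rw [← sq, ← sq, mul_pow, Real.sq_sqrt hMpos.le] at h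
    exact h
  -- `Inf_{jm} ≥ 4 M`
  have hinf : 4 * I jm ≤ influence jm p := by
    rw [influence_eq_sum_sq_fourier, ← hg]
    have : I jm ≤ ∑ S with jm ∈ S, g S ^ 2 := by
      rw [hI]
      exact Finset.sum_le_sum_of_subset_of_nonneg
        (fun S hS => Finset.mem_filter.mpr ⟨Finset.mem_univ _, (Finset.mem_filter.mp hS).2.2⟩)
        fun _ _ _ => sq_nonneg _
    linarith
  refine ⟨jm, le_trans ?_ hinf⟩
  have h3 : (ε / d) ^ 2 ≤ W D ^ 2 := pow_le_pow_left₀ (by positivity) hWD 2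
  have h4 : (ε / d) ^ 2 / K ^ 2 ≤ I jm := by
    rw [div_le_iff₀ (pow_pos hK 2)]
    linarith
  calc 4 * (ε / (d * K)) ^ 2 = 4 * ((ε / d) ^ 2 / K ^ 2) := by
        rw [div_mul_eq_div_div, div_pow]
    _ ≤ 4 * I jm := by linarith

/-- **PB-AA on the completely-bounded corner, with the sharp exponents `(2, 2)`**: a pseudo-bounded `p` of order
`T ≥ 1` (`p ∈ K_T`; Walsh degree `≤ 2T`) whose ordered completely bounded norm is `≤ K` and whose variance is
`≥ ε > 0` has a variable with `Infᵢ[p] ≥ (ε/(T K))²`.  (`K_T ∋ p ↦` representative `Σⱼ qⱼ²` of total degree `≤ 2T`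
with the same cube function; then `exists_influence_ge_of_cb` with `d = 2T`.)
[cite: EscuderoGutierrez2023, Thm. 1.8] [cite: BansalSinhaDeWolf2022, Thm. 1.3] [cite: KaniewskiLeeDewolf2015, Def. 7] -/
theorem pseudoBoundedAA_cbCorner {T : ℕ} (hT : 1 ≤ T) (p : MvPolynomial (Fin N) ℝ) (hp : PseudoBounded T p)
    {K : ℝ} (hK : 0 < K)
    (hcb : ∀ (m : ℕ) (A : Fin N → Matrix (Fin m) (Fin m) ℝ) (v f : Fin m → ℝ),
      (∀ j w, ∑ a, (A j *ᵥ w) a ^ 2 ≤ ∑ a, w a ^ 2) → ∑ a, v a ^ 2 = 1 → ∑ a, f a ^ 2 = 1 →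
      f ⬝ᵥ ((∑ S : Finset (Fin N), cubeFourierCoeff (evalBool p) S • ((S.sort).map A).prod) *ᵥ v) ≤ K)
    {ε : ℝ} (hε : 0 < ε) (hvar : ε ≤ boolVariance p) :
    ∃ i : Fin N, (ε / (T * K)) ^ 2 ≤ influence i p := by
  obtain ⟨p', hdeg, -, hfun⟩ := exists_representative_of_pseudoBounded hp
  have hvar' : boolVariance p' = boolVariance p := by unfold boolVariance; rw [hfun]
  have hinf : ∀ i, influence i p' = influence i p := fun i => by unfold influence; rw [hfun]
  have hd : 1 ≤ 2 * T := by omega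
  rw [← hfun] at hcb
  obtain ⟨i, hi⟩ := exists_influence_ge_of_cb hd p' hdeg hK hcb hε (hvar' ▸ hvar)
  refine ⟨i, ?_⟩
  rw [← hinf i]
  refine le_trans (le_of_eq ?_) hi
  push_cast
  ring

/-- **The same, in the literal inline vocabulary of the route decl `PseudoBoundedAA`** (its `let ev`, `let avg`,
the SOS certificate spelled out, `xⁱ = Function.update x i (!x i)`): on the completely-bounded corner (ordered
cb-norm `≤ 1`) the body of `PseudoBoundedAA` holds with `(c, C) = (2, 1)`, i.e. `∃ i, 1·(ε/T)² ≤ Infᵢ[p]`.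
[cite: EscuderoGutierrez2023, Thm. 1.8] [cite: BansalSinhaDeWolf2022, Thm. 1.3] [cite: AaronsonAmbainis2014, Conj. 6] -/
theorem pseudoBoundedAA_cbCorner_literal (N T : ℕ) (p : MvPolynomial (Fin N) ℝ) (ε : ℝ)
    (hcb : ∀ (m : ℕ) (A : Fin N → Matrix (Fin m) (Fin m) ℝ) (v f : Fin m → ℝ),
      (∀ j w, ∑ a, (A j *ᵥ w) a ^ 2 ≤ ∑ a, w a ^ 2) → ∑ a, v a ^ 2 = 1 → ∑ a, f a ^ 2 = 1 →
      f ⬝ᵥ ((∑ S : Finset (Fin N), cubeFourierCoeff (evalBool p) S • ((S.sort).map A).prod) *ᵥ v) ≤ 1) :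
    let ev : MvPolynomial (Fin N) ℝ → (Fin N → Bool) → ℝ :=
      fun f x => MvPolynomial.eval (fun k => if x k then (1 : ℝ) else 0) f
    let avg : ((Fin N → Bool) → ℝ) → ℝ := fun g => (∑ x : Fin N → Bool, g x) / (2 : ℝ) ^ N
    1 ≤ T →
    (∃ (m : ℕ) (q r : Fin m → MvPolynomial (Fin N) ℝ),
        (∀ j, (q j).totalDegree ≤ T ∧ (r j).totalDegree ≤ T) ∧
          ∀ x : Fin N → Bool, ev p x = ∑ j, ev (q j) x ^ 2 ∧ 1 - ev p x = ∑ j, ev (r j) x ^ 2) →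
    0 < ε → ε ≤ (avg fun x => (ev p x - avg (ev p)) ^ 2) →
    ∃ i : Fin N, 1 * (ε / T) ^ 2 ≤ (avg fun x => (ev p x - ev p (Function.update x i (!x i))) ^ 2) := by
  intro ev avg hT hPB hε hv
  change PseudoBounded T p at hPB
  change ε ≤ boolVariance p at hv
  change ∃ i : Fin N, 1 * (ε / T) ^ 2 ≤ influence i p
  obtain ⟨i, hi⟩ := pseudoBoundedAA_cbCorner hT p hPB one_pos hcb hε hv
  exact ⟨i, by simpa using hi⟩

end Summit.QuantumAdvantage.QuantumAdvantage.Theorems.SosSandwich.CompletelyBoundedCorner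

end
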